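import Literature.MathematicalPhysics.QuantumLattice.MagneticHubbardTorusGauge
import Literature.MathematicalPhysics.QuantumLattice.PairCorrelationsProofs
import Literature.MathematicalPhysics.QuantumLattice.FinDimSpectrumSectorGibbsLimit
import Mathlib.Analysis.SpecialFunctions.Complex.CircleAddChar
import Mathlib.Analysis.SpecialFunctions.Trigonometric.Bounds
import HarnessLib

/-!
# Gauge-twist softness of the Hubbard torus

Part 1 of an OBSTRUCTION lemma for the summit `HubbardSuperconductivity` (parts 2–3:
`SoloBlindTwistAveraging`, `SoloBlindOrderNotEnergyRobust`). For the Hubbard torus `hubbardTorus 2 L t U`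
(any `t U : ℝ`, side `L ≥ 3`) and the Bloch / Lieb–Schultz–Mattis twist `W_m = exp(2πi m X₁/L)`
(`twistOp m`, a `phaseGauge` by the character `x ↦ χ(m x₁)` of `ℤ/L`):

* `twistOp_mul_hubbardTorus_mul_conjTranspose` — `W_m H W_mᴴ` is the magnetic Hubbard torus with the
  FLAT connection `χ(m)` on every `e₁`-bond (pure gauge of winding `m`), hence differs from `H` by
  `-t((χ(m)-1)·hop + h.c.)` (`magneticHubbardTorus_flatConfig_sub`);
* `re_twist_energy` — the exact energy of a twisted state:
  `re ⟨W_mᴴψ, H W_mᴴψ⟩ = re ⟨ψ, Hψ⟩ - 2 re((χ(m)-1) · t · hopAmp ψ)`;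
* `re_twist_energy_le_minEnergyOn_add` — **softness**: for every normalised ground state `ψ` of the joint
  sector `(N, S^z = M)` and every winding `±n`, `W_{±n}ᴴψ` is a unit vector of the same sector
  (`twist_mem_szSector`, `star_twist_dotProduct_twist`) with
  `re ⟨W_{±n}ᴴψ, H W_{±n}ᴴψ⟩ ≤ E₀ + 8π²|t|(n² + n)`, `E₀ = minEnergyOn`.

The cost is `O(1)` in `L`, not the naive `O(L)`: the variational principle at windings `±1` gives
`re((χ(±1)-1) t·hopAmp ψ) ≤ 0`, whence `-re((χ(1)ⁿ-1) t·hopAmp ψ) ≤ (n²+n)/2·|χ(1)-1|²·|t|·|hopAmp ψ|`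
(`neg_re_pow_sub_one_mul_le`), and `|χ(1)-1| ≤ 2π/L`, `|hopAmp ψ| ≤ 2L²` — the mechanism of Bohm's and
Watanabe's proofs of the Bloch theorem, made quantitative on the 2D torus.
References. D. Bohm, Phys. Rev. 75 (1949) 502; E. Lieb, T. Schultz, D. Mattis, Ann. Phys. 16 (1961) 407
(twist operator); H. Watanabe, J. Stat. Phys. 177 (2019) 717, arXiv:1904.02700, §2.2.1 and §4.1 (2D,
`O(L_y/L_x)` remainder); Y. Tada, T. Koma, J. Stat. Phys. 165 (2016) 455, arXiv:1605.06586, Thm. 1;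
T. Koma, H. Tasaki, Phys. Rev. Lett. 68 (1992) 3248, eqs. (5)–(8) (`phaseGauge`). Elementary; [folklore].
-/

noncomputable section

namespace Summit.HubbardSuperconductivity.HubbardSuperconductivity.Theorems

open Matrix Finset Literature.MathematicalPhysics.QuantumLattice
  Literature.MathematicalPhysics.QuantumFieldTheory
open Literature.Probability.LatticeModels (Torus.proj)
open scoped ComplexConjugate

/-! ### A lemma on unimodular complex numbers -/

namespace GaugeTwist

/-- For `‖a‖ = 1`: `re (a - 1) = -‖a - 1‖² / 2`. [folklore] -/
theorem re_sub_one_eq_of_norm_eq_one {a : ℂ} (ha : ‖a‖ = 1) :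
    (a - 1).re = -‖a - 1‖ ^ 2 / 2 := by
  have h1 : a.re * a.re + a.im * a.im = 1 := by
    have := Complex.normSq_eq_norm_sq a
    rw [ha, one_pow, Complex.normSq_apply] at this
    linarith
  rw [Complex.sq_norm, Complex.normSq_apply]
  simp only [Complex.sub_re, Complex.one_re, Complex.sub_im, Complex.one_im, sub_zero]
  nlinarith [h1]

/-- For `‖a‖ = 1`: `|im (a ^ n)| ≤ n |im a|` (i.e. `|sin nθ| ≤ n |sin θ|`). [folklore] -/
theorem abs_im_pow_le_of_norm_eq_one {a : ℂ} (ha : ‖a‖ = 1) (n : ℕ) :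
    |(a ^ n).im| ≤ n * |a.im| := by
  induction n with
  | zero => simp
  | succ n ih =>
    rw [pow_succ, Complex.mul_im]
    have hre_n : |(a ^ n).re| ≤ 1 := by
      have := Complex.abs_re_le_norm (a ^ n)
      rwa [norm_pow, ha, one_pow] at this
    have hre : |a.re| ≤ 1 := by
      have := Complex.abs_re_le_norm a
      rwa [ha] at this
    calc |(a ^ n).re * a.im + (a ^ n).im * a.re|
        ≤ |(a ^ n).re * a.im| + |(a ^ n).im * a.re| := abs_add_le _ _
      _ = |(a ^ n).re| * |a.im| + |(a ^ n).im| * |a.re| := by rw [abs_mul, abs_mul]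
      _ ≤ 1 * |a.im| + n * |a.im| * 1 := by gcongr
      _ = (n + 1 : ℕ) * |a.im| := by push_cast; ring

/-- For `‖a‖ = 1`: `‖a ^ n - 1‖ ≤ n ‖a - 1‖`. [folklore] -/
theorem norm_pow_sub_one_le_of_norm_eq_one {a : ℂ} (ha : ‖a‖ = 1) (n : ℕ) :
    ‖a ^ n - 1‖ ≤ n * ‖a - 1‖ := by
  induction n with
  | zero => simp
  | succ n ih =>
    have h : a ^ (n + 1) - 1 = a ^ n * (a - 1) + (a ^ n - 1) := by ring
    rw [h]
    calc ‖a ^ n * (a - 1) + (a ^ n - 1)‖ ≤ ‖a ^ n * (a - 1)‖ + ‖a ^ n - 1‖ := norm_add_le _ _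
      _ = ‖a - 1‖ + ‖a ^ n - 1‖ := by rw [norm_mul, norm_pow, ha, one_pow, one_mul]
      _ ≤ ‖a - 1‖ + n * ‖a - 1‖ := by gcongr
      _ = (n + 1 : ℕ) * ‖a - 1‖ := by push_cast; ring

/-- **Twist lemma for unimodular phases.** If `‖a‖ = 1` and both `re ((a - 1) w) ≤ 0` and
`re ((conj a - 1) w) ≤ 0`, then for every `n`,
`-re ((a ^ n - 1) w) ≤ (n² + n)/2 · ‖a - 1‖² · ‖w‖`. (With `a = e^{iθ}` this is the estimate
`(1 - cos nθ) re w + sin nθ · im w ≤ (n² + n)(1 - cos θ)|w|` from `|sin nθ| ≤ n |sin θ|` and the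
hypotheses `|sin θ · im w| ≤ (1 - cos θ) re w`.) [folklore] -/
theorem neg_re_pow_sub_one_mul_le {a w : ℂ} (ha : ‖a‖ = 1) (h₁ : ((a - 1) * w).re ≤ 0)
    (h₂ : ((conj a - 1) * w).re ≤ 0) (n : ℕ) :
    -((a ^ n - 1) * w).re ≤ (n ^ 2 + n) / 2 * ‖a - 1‖ ^ 2 * ‖w‖ := by
  have han : ‖a ^ n‖ = 1 := by rw [norm_pow, ha, one_pow]
  have hre1 : (a - 1).re = -‖a - 1‖ ^ 2 / 2 := re_sub_one_eq_of_norm_eq_one ha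
  have hren : (a ^ n - 1).re = -‖a ^ n - 1‖ ^ 2 / 2 := re_sub_one_eq_of_norm_eq_one han
  -- the hypotheses in coordinates: `|im a · im w| ≤ (‖a-1‖²/2) re w`
  have e₁ : ((a - 1) * w).re = (a - 1).re * w.re - a.im * w.im := by
    simp [Complex.mul_re]
  have e₂ : ((conj a - 1) * w).re = (a - 1).re * w.re + a.im * w.im := by
    simp [Complex.mul_re, Complex.sub_re, Complex.sub_im]
  rw [e₁, hre1] at h₁
  rw [e₂, hre1] at h₂
  have hkey : |a.im * w.im| ≤ ‖a - 1‖ ^ 2 / 2 * w.re := by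
    rw [abs_le]; constructor <;> nlinarith
  have hwre : w.re ≤ ‖w‖ := Complex.re_le_norm w
  have hwre' : ‖a - 1‖ ^ 2 / 2 * w.re ≤ ‖a - 1‖ ^ 2 / 2 * ‖w‖ :=
    mul_le_mul_of_nonneg_left hwre (by positivity)
  -- the target in coordinates
  have e₃ : -((a ^ n - 1) * w).re = ‖a ^ n - 1‖ ^ 2 / 2 * w.re + (a ^ n).im * w.im := by
    simp only [Complex.mul_re, Complex.sub_im, Complex.one_im, sub_zero]
    rw [hren]; ring
  rw [e₃]
  have hA : ‖a ^ n - 1‖ ^ 2 / 2 * w.re ≤ n ^ 2 * ‖a - 1‖ ^ 2 / 2 * ‖w‖ := by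
    have hp : ‖a ^ n - 1‖ ^ 2 ≤ n ^ 2 * ‖a - 1‖ ^ 2 := by
      have := norm_pow_sub_one_le_of_norm_eq_one ha n
      calc ‖a ^ n - 1‖ ^ 2 ≤ (n * ‖a - 1‖) ^ 2 := by gcongr
        _ = n ^ 2 * ‖a - 1‖ ^ 2 := by ring
    by_cases hw : 0 ≤ w.re
    · calc ‖a ^ n - 1‖ ^ 2 / 2 * w.re ≤ n ^ 2 * ‖a - 1‖ ^ 2 / 2 * w.re := by gcongr
        _ ≤ n ^ 2 * ‖a - 1‖ ^ 2 / 2 * ‖w‖ := by gcongr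
    · push Not at hw
      calc ‖a ^ n - 1‖ ^ 2 / 2 * w.re ≤ 0 :=
            mul_nonpos_of_nonneg_of_nonpos (by positivity) hw.le
        _ ≤ n ^ 2 * ‖a - 1‖ ^ 2 / 2 * ‖w‖ := by positivity
  have hB : (a ^ n).im * w.im ≤ n * (‖a - 1‖ ^ 2 / 2 * ‖w‖) := by
    calc (a ^ n).im * w.im ≤ |(a ^ n).im * w.im| := le_abs_self _
      _ = |(a ^ n).im| * |w.im| := abs_mul _ _
      _ ≤ n * |a.im| * |w.im| := by gcongr; exact abs_im_pow_le_of_norm_eq_one ha n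
      _ = n * |a.im * w.im| := by rw [abs_mul]; ring
      _ ≤ n * (‖a - 1‖ ^ 2 / 2 * ‖w‖) := by gcongr; exact hkey.trans hwre'
  calc ‖a ^ n - 1‖ ^ 2 / 2 * w.re + (a ^ n).im * w.im
      ≤ n ^ 2 * ‖a - 1‖ ^ 2 / 2 * ‖w‖ + n * (‖a - 1‖ ^ 2 / 2 * ‖w‖) := add_le_add hA hB
    _ = (n ^ 2 + n) / 2 * ‖a - 1‖ ^ 2 * ‖w‖ := by ring

/-! ### The twist: a pure gauge with winding `m ∈ ℤ/L` around the `e₁`-cycle -/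

variable {L : ℕ} [NeZero L]

/-- The twist character of winding `m : ℤ/L`: `x ↦ e^{2πi m x₁/L}` on the torus `(ℤ/L)²`.
Watanabe, J. Stat. Phys. 177 (2019) 717, §2.2.1 (twist operator `U_m`). [folklore] -/
def twistChar (m : ZMod L) (x : Site 2 L) : Circle := ZMod.toCircle (m * x 0)

/-- The twist (Lieb–Schultz–Mattis / Bloch) unitary `W_m = exp(2πi m X₁/L)`, `X₁ = Σ_x x₁ n_x`, as
the site-phase gauge transformation of `twistChar m`. [folklore] -/
def twistOp (m : ZMod L) :
    Matrix (Finset (Orb (FermionTorus 2 L))) (Finset (Orb (FermionTorus 2 L))) ℂ :=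
  phaseGauge fun u : FermionTorus 2 L => twistChar m u.toTorusSite

/-- The flat gauge field with the constant phase `a` on every `e₁`-edge and `1` on the `e₂`-edges.
[folklore] -/
def flatConfig (a : Circle) : GaugeConfig 2 L Circle := fun e => if e.2 = 0 then a else 1

omit [NeZero L] in
/-- `flatConfig a` on an edge, unfolded. [folklore] -/
theorem flatConfig_apply (a : Circle) (x : Site 2 L) (i : Fin 2) :
    flatConfig a (x, i) = if i = 0 then a else 1 := rfl

/-- The pure gauge of the inverse twist character is the flat field with phase `e^{2πi m/L}`:
`(twistChar m)⁻¹(x) · 1 · twistChar m (x + eᵢ) = toCircle (m · (eᵢ)₁)`. [folklore] -/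
theorem gaugeTransform_twistChar_inv_one (m : ZMod L) :
    gaugeTransform (twistChar m)⁻¹ (1 : GaugeConfig 2 L Circle) = flatConfig (ZMod.toCircle m) := by
  funext ⟨x, i⟩
  simp only [gaugeTransform, Pi.inv_apply, Pi.one_apply, mul_one, inv_inv, flatConfig_apply,
    twistChar, Site.shift]
  fin_cases i
  · simp only [Fin.zero_eta, Fin.isValue, Pi.add_apply, Pi.single_eq_same, ↓reduceIte]
    rw [mul_add, mul_one, AddChar.map_add_eq_mul]
    rw [inv_mul_cancel_left]
  · simp only [Fin.mk_one, Fin.isValue, Pi.add_apply, one_ne_zero, ↓reduceIte]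
    rw [Pi.single_eq_of_ne (by decide : (0 : Fin 2) ≠ 1), add_zero, inv_mul_cancel]

/-- **The twist is a pure gauge** (`L ≥ 3`): `W_m H(t,U) W_mᴴ = H_{flat(e^{2πi m/L})}(t,U)`, the
Hubbard torus with the Peierls phase `e^{2πi m/L}` on every `e₁`-bond. Lieb, PRL 73 (1994) 2158
(gauge invariance); Watanabe (2019) §2.2.3. [folklore] -/
theorem twistOp_mul_hubbardTorus_mul_conjTranspose (hL : 3 ≤ L) (m : ZMod L) (t U : ℝ) :
    twistOp m * hubbardTorus 2 L t U * (twistOp m)ᴴ =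
      magneticHubbardTorus L (flatConfig (ZMod.toCircle m)) t U := by
  rw [← magneticHubbardTorus_one_eq_hubbardTorus hL, twistOp,
    phaseGauge_mul_magneticHubbardTorus_mul_conjTranspose, gaugeTransform_twistChar_inv_one]

/-- The `e₁`-hopping operator `K₁ = Σ_{x,σ} c†_{x+e₁,σ} c_{x,σ}` (so that the `e₁`-kinetic term is
`-t (K₁ + K₁ᴴ)` and the `e₁`-current is `-it (K₁ - K₁ᴴ)`). [folklore] -/
def hopE1 : Matrix (Finset (Orb (FermionTorus 2 L))) (Finset (Orb (FermionTorus 2 L))) ℂ :=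
  ∑ x : Site 2 L, ∑ σ : Fin 2,
    creation (orb (FermionTorus.ofTorusSite (x.shift 0)) σ) *
      annihilation (orb (FermionTorus.ofTorusSite x) σ)

/-- **The twisted Hamiltonian differs from the untwisted one by a hopping perturbation**:
`H_{flat a} - H_1 = -t [(a - 1) K₁ + (ā - 1) K₁ᴴ]`. [folklore] -/
theorem magneticHubbardTorus_flatConfig_sub (a : Circle) (t U : ℝ) :
    magneticHubbardTorus L (flatConfig a) t U - magneticHubbardTorus L 1 t U =
      (-(t : ℂ)) • (((a : ℂ) - 1) • hopE1 + (conj (a : ℂ) - 1) • (hopE1)ᴴ) := by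
  simp only [magneticHubbardTorus, flatConfig_apply, hopE1, Fin.sum_univ_two, Fin.isValue,
    ↓reduceIte, one_ne_zero, Pi.one_apply, Circle.coe_one, map_one, one_smul,
    add_sub_add_right_eq_sub, Matrix.conjTranspose_sum, Matrix.conjTranspose_add,
    conjTranspose_creation_mul_annihilation]
  rw [← smul_sub, ← Finset.sum_sub_distrib]
  congr 1
  simp only [Finset.smul_sum, ← Finset.sum_add_distrib]
  refine Finset.sum_congr rfl fun x _ => ?_
  module

/-! ### Expectations in twisted states -/

omit [NeZero L] in
/-- `⟨Wᴴψ, A Wᴴψ⟩ = ⟨ψ, (W A Wᴴ) ψ⟩`. [folklore] -/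
theorem star_conjTranspose_mulVec_dotProduct {n : Type*} [Fintype n] (W A : Matrix n n ℂ)
    (ψ : n → ℂ) :
    star (Wᴴ *ᵥ ψ) ⬝ᵥ (A *ᵥ (Wᴴ *ᵥ ψ)) = star ψ ⬝ᵥ ((W * A * Wᴴ) *ᵥ ψ) := by
  rw [star_mulVec, conjTranspose_conjTranspose, ← dotProduct_mulVec, mulVec_mulVec, mulVec_mulVec]

omit [NeZero L] in
/-- The states `W_gᴴ ψ` have the same norm as `ψ` (`W_g` is unitary). [folklore] -/
theorem star_phaseGauge_conjTranspose_mulVec_dotProduct {Λ : Type*} [LinearOrder Λ] [Fintype Λ]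
    (g : Λ → Circle) (ψ : Fock (Orb Λ)) :
    star ((phaseGauge g)ᴴ *ᵥ ψ) ⬝ᵥ ((phaseGauge g)ᴴ *ᵥ ψ) = star ψ ⬝ᵥ ψ := by
  rw [star_mulVec, conjTranspose_conjTranspose, ← dotProduct_mulVec, mulVec_mulVec,
    phaseGauge_mul_conjTranspose_self, one_mulVec]

/-- The twisted states `W_mᴴ ψ` stay normalised. [folklore] -/
theorem star_twist_dotProduct_twist (m : ZMod L) (ψ : Fock (Orb (FermionTorus 2 L))) :
    star ((twistOp m)ᴴ *ᵥ ψ) ⬝ᵥ ((twistOp m)ᴴ *ᵥ ψ) = star ψ ⬝ᵥ ψ :=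
  star_phaseGauge_conjTranspose_mulVec_dotProduct _ ψ

/-- The twisted states `W_mᴴ ψ` stay in the joint sector `(N, S^z = M)`. [folklore] -/
theorem twist_mem_szSector (m : ZMod L) {N : ℕ} {M : ℝ} {ψ : Fock (Orb (FermionTorus 2 L))}
    (h : ψ ∈ szSector N M) : (twistOp m)ᴴ *ᵥ ψ ∈ szSector N M :=
  phaseGauge_conjTranspose_mulVec_mem_szSector _ h

/-- The `e₁`-hopping amplitude `κ(ψ) = ⟨ψ, K₁ ψ⟩ = Σ_{x,σ} ⟨ψ, c†_{x+e₁,σ} c_{x,σ} ψ⟩`. [folklore] -/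
def hopAmp (ψ : Fock (Orb (FermionTorus 2 L))) : ℂ := star ψ ⬝ᵥ (hopE1 *ᵥ ψ)

/-- **Energy of a twisted state** (`L ≥ 3`): for every state `ψ` and winding `m`,
`re ⟨W_mᴴψ, H W_mᴴψ⟩ = re ⟨ψ, Hψ⟩ - 2 re ((e^{2πi m/L} - 1) · t κ(ψ))`, i.e.
`= re⟨ψ,Hψ⟩ + (1 - cos θ_m)·(-t·2 re κ) + sin θ_m · (2t im κ)` — the kinetic `e₁`-energy and the
`e₁`-current of `ψ` weighted by `1 - cos θ_m` and `sin θ_m`, `θ_m = 2πm/L`. [folklore] -/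
theorem re_twist_energy (hL : 3 ≤ L) (m : ZMod L) (t U : ℝ) (ψ : Fock (Orb (FermionTorus 2 L))) :
    (star ((twistOp m)ᴴ *ᵥ ψ) ⬝ᵥ (hubbardTorus 2 L t U *ᵥ ((twistOp m)ᴴ *ᵥ ψ))).re =
      (star ψ ⬝ᵥ (hubbardTorus 2 L t U *ᵥ ψ)).re -
        2 * (((ZMod.toCircle m : ℂ) - 1) * (t * hopAmp ψ)).re := by
  rw [star_conjTranspose_mulVec_dotProduct, twistOp_mul_hubbardTorus_mul_conjTranspose hL,
    (sub_eq_iff_eq_add.1 (magneticHubbardTorus_flatConfig_sub (ZMod.toCircle m) t U)),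
    magneticHubbardTorus_one_eq_hubbardTorus hL]
  simp only [Matrix.add_mulVec, Matrix.smul_mulVec, dotProduct_add, dotProduct_smul, smul_eq_mul,
    hopAmp]
  rw [star_dotProduct_conjTranspose_mulVec_eq_star]
  set κ : ℂ := star ψ ⬝ᵥ (hopE1 *ᵥ ψ)
  have hre : ((conj (ZMod.toCircle m : ℂ) - 1) * star κ).re =
      (((ZMod.toCircle m : ℂ) - 1) * κ).re := by
    have : (conj (ZMod.toCircle m : ℂ) - 1) * star κ = conj ((((ZMod.toCircle m : ℂ)) - 1) * κ) := by
      simp [map_sub, map_mul, map_one]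
    rw [this, Complex.conj_re]
  simp only [Complex.add_re, Complex.mul_re, Complex.mul_im, Complex.neg_re, Complex.neg_im,
    Complex.ofReal_re, Complex.ofReal_im, neg_zero, zero_mul, sub_zero, add_zero] at *
  rw [hre]
  ring

/-- **The hopping amplitude is bounded by the number of `e₁`-bonds**: `‖κ(ψ)‖ ≤ 2L²` for a unit
vector `ψ` (each `c†_{x+e₁,σ} c_{x,σ}` is a product of two contractions). [folklore] -/
theorem norm_hopAmp_le {ψ : Fock (Orb (FermionTorus 2 L))} (h1 : star ψ ⬝ᵥ ψ = 1) :
    ‖hopAmp ψ‖ ≤ 2 * (L : ℝ) ^ 2 := by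
  have hψ : ‖(WithLp.toLp 2 ψ : EuclideanSpace ℂ (Finset (Orb (FermionTorus 2 L))))‖ = 1 := by
    have h := norm_toLp_sq_eq_re ψ
    rw [h1, Complex.one_re] at h
    have h0 : 0 ≤ ‖(WithLp.toLp 2 ψ : EuclideanSpace ℂ (Finset (Orb (FermionTorus 2 L))))‖ :=
      norm_nonneg _
    nlinarith
  have hterm : ∀ (p q : Orb (FermionTorus 2 L)),
      ‖star ψ ⬝ᵥ ((creation p * annihilation q) *ᵥ ψ)‖ ≤ 1 := by
    intro p q
    rw [← mulVec_mulVec, creation, dotProduct_mulVec, ← star_mulVec, star_dotProduct_eq_inner]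
    refine (norm_inner_le_norm _ _).trans ?_
    calc _ ≤ ‖(WithLp.toLp 2 ψ : EuclideanSpace ℂ (Finset (Orb (FermionTorus 2 L))))‖ *
          ‖(WithLp.toLp 2 ψ : EuclideanSpace ℂ (Finset (Orb (FermionTorus 2 L))))‖ :=
          mul_le_mul (norm_toLp_annihilation_mulVec_le _ _) (norm_toLp_annihilation_mulVec_le _ _)
            (norm_nonneg _) (norm_nonneg _)
      _ = 1 := by rw [hψ, mul_one]
  unfold hopAmp hopE1
  simp only [Matrix.sum_mulVec, dotProduct_sum]
  calc ‖∑ x : Site 2 L, ∑ σ : Fin 2, star ψ ⬝ᵥ ((creation (orb (FermionTorus.ofTorusSite (x.shift 0)) σ) *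
          annihilation (orb (FermionTorus.ofTorusSite x) σ)) *ᵥ ψ)‖
      ≤ ∑ x : Site 2 L, ∑ σ : Fin 2, ‖star ψ ⬝ᵥ ((creation (orb (FermionTorus.ofTorusSite (x.shift 0)) σ) *
          annihilation (orb (FermionTorus.ofTorusSite x) σ)) *ᵥ ψ)‖ :=
        (norm_sum_le _ _).trans (Finset.sum_le_sum fun x _ => norm_sum_le _ _)
    _ ≤ ∑ x : Site 2 L, ∑ σ : Fin 2, (1 : ℝ) :=
        Finset.sum_le_sum fun x _ => Finset.sum_le_sum fun σ _ => hterm _ _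
    _ = 2 * (L : ℝ) ^ 2 := by
        simp only [Finset.sum_const, Finset.card_univ, Fintype.card_fin, nsmul_eq_mul, mul_one]
        rw [Fintype.card_fun, ZMod.card, Fintype.card_fin]
        push_cast
        ring

/-- `‖e^{2πi/L} - 1‖ ≤ 2π/L`. [folklore] -/
theorem norm_toCircle_one_sub_one_le :
    ‖(ZMod.toCircle (1 : ZMod L) : ℂ) - 1‖ ≤ 2 * Real.pi / L := by
  have h : (ZMod.toCircle (1 : ZMod L) : ℂ) = Complex.exp (Complex.I * (2 * Real.pi / L : ℝ)) := by
    have := ZMod.toCircle_natCast (N := L) 1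
    rw [Nat.cast_one] at this
    rw [this]
    congr 1
    push_cast
    ring
  rw [h]
  refine Real.norm_exp_I_mul_ofReal_sub_one_le.trans ?_
  rw [Real.norm_eq_abs, abs_of_nonneg (by positivity)]

/-- The Hubbard torus Hamiltonian is Hermitian (`L ≥ 3`, via the Peierls form). [folklore] -/
theorem hubbardTorus_isHermitian (hL : 3 ≤ L) (t U : ℝ) : (hubbardTorus 2 L t U).IsHermitian := by
  rw [← magneticHubbardTorus_one_eq_hubbardTorus hL]
  exact magneticHubbardTorus_isHermitian 1 t U

/-- **Gauge-twist softness of sector ground states** (`L ≥ 3`). Let `ψ` be a normalised ground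
state of the Hubbard torus `H = hubbardTorus 2 L t U` in a joint sector `(N, S^z = M)`, with sector
energy `E₀`. Then for every `n` and both windings `m = ±n`, the twisted state `W_mᴴ ψ`
(`W_m = exp(2πi m X₁/L)`) is a unit vector of the same sector whose energy exceeds `E₀` by at most
`8π² |t| (n² + n)` — uniformly in `L`, `U`, `N`, `M`. Proof: twisting by `±1` cannot lower the
energy (variational principle), which bounds the ground-state current by the kinetic energy
(Bloch's argument); the unimodular-phase lemma `neg_re_pow_sub_one_mul_le` then controls all
windings, and `‖e^{2πi/L} - 1‖² · ‖t κ‖ ≤ (2π/L)² · 2|t|L²`. Bloch / Bohm (1949); Watanabe,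
J. Stat. Phys. 177 (2019) 717, §4 (energy cost `O(1/L^{d-2})` of a twist); Lieb–Schultz–Mattis
(1961). [folklore] -/
theorem re_twist_energy_le_minEnergyOn_add (hL : 3 ≤ L) (t U : ℝ) {N : ℕ} {M : ℝ}
    {ψ : Fock (Orb (FermionTorus 2 L))} (hψ : IsGroundStateInSector (hubbardTorus 2 L t U) N M ψ)
    (h1 : star ψ ⬝ᵥ ψ = 1) (n : ℕ) {m : ZMod L} (hm : m = n ∨ m = -(n : ZMod L)) :
    (star ((twistOp m)ᴴ *ᵥ ψ) ⬝ᵥ (hubbardTorus 2 L t U *ᵥ ((twistOp m)ᴴ *ᵥ ψ))).re ≤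
      (hubbardTorus 2 L t U).minEnergyOn (szSector N M) + 8 * Real.pi ^ 2 * |t| * (n ^ 2 + n) := by
  set H := hubbardTorus 2 L t U with hH
  set E₀ := H.minEnergyOn (szSector N M) with hE₀
  set ζ : ℂ := (ZMod.toCircle (1 : ZMod L) : ℂ) with hζ
  set w : ℂ := (t : ℂ) * hopAmp ψ with hw
  obtain ⟨hmem, -, heig⟩ := hψ
  -- `re ⟨ψ, Hψ⟩ = E₀`
  have hE : (star ψ ⬝ᵥ (H *ᵥ ψ)).re = E₀ := by
    rw [heig, dotProduct_smul, h1, smul_eq_mul, mul_one, Complex.ofReal_re]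
  -- energies of all twisted states
  have hEm : ∀ m' : ZMod L, (star ((twistOp m')ᴴ *ᵥ ψ) ⬝ᵥ (H *ᵥ ((twistOp m')ᴴ *ᵥ ψ))).re =
      E₀ - 2 * (((ZMod.toCircle m' : ℂ) - 1) * w).re := by
    intro m'
    rw [re_twist_energy hL m' t U ψ, hE]
  -- variational principle for the twisted states
  have hvar : ∀ m' : ZMod L, E₀ ≤ (star ((twistOp m')ᴴ *ᵥ ψ) ⬝ᵥ (H *ᵥ ((twistOp m')ᴴ *ᵥ ψ))).re :=
    fun m' => minEnergyOn_le_rayleigh_of_mem (hubbardTorus_isHermitian hL t U) _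
      (twist_mem_szSector m' hmem) (by rw [star_twist_dotProduct_twist, h1])
  have hζ1 : ‖ζ‖ = 1 := Circle.norm_coe _
  have hζn : (ZMod.toCircle (n : ZMod L) : ℂ) = ζ ^ n := by
    rw [hζ, ← Circle.coe_pow, ← AddChar.map_nsmul_eq_pow, nsmul_eq_mul, mul_one]
  have hζneg : ∀ m' : ZMod L, (ZMod.toCircle (-m') : ℂ) = conj (ZMod.toCircle m' : ℂ) := by
    intro m'
    rw [AddChar.map_neg_eq_inv, Circle.coe_inv_eq_conj]
  -- Bloch: twisting by `±1` does not lower the energy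
  have hpos : ((ζ - 1) * w).re ≤ 0 := by
    have := (hvar 1).trans_eq (hEm 1)
    linarith
  have hneg : ((conj ζ - 1) * w).re ≤ 0 := by
    have := (hvar (-1)).trans_eq (hEm (-1))
    rw [hζneg 1] at this
    linarith
  -- the bound on `‖ζ - 1‖² ‖w‖`
  have hL0 : (0 : ℝ) < L := by exact_mod_cast (show 0 < L by omega)
  have hprod : ‖ζ - 1‖ ^ 2 * ‖w‖ ≤ (2 * Real.pi / L) ^ 2 * (|t| * (2 * (L : ℝ) ^ 2)) := by
    have ha : ‖ζ - 1‖ ^ 2 ≤ (2 * Real.pi / L) ^ 2 := by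
      have := norm_toCircle_one_sub_one_le (L := L)
      gcongr
    have hb : ‖w‖ ≤ |t| * (2 * (L : ℝ) ^ 2) := by
      rw [hw, norm_mul, Complex.norm_real, Real.norm_eq_abs]
      exact mul_le_mul_of_nonneg_left (norm_hopAmp_le h1) (abs_nonneg t)
    exact mul_le_mul ha hb (norm_nonneg _) (by positivity)
  have hfin : (n ^ 2 + n : ℝ) * (‖ζ - 1‖ ^ 2 * ‖w‖) ≤ 8 * Real.pi ^ 2 * |t| * (n ^ 2 + n) := by
    calc (n ^ 2 + n : ℝ) * (‖ζ - 1‖ ^ 2 * ‖w‖)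
        ≤ (n ^ 2 + n : ℝ) * ((2 * Real.pi / L) ^ 2 * (|t| * (2 * (L : ℝ) ^ 2))) := by gcongr
      _ = 8 * Real.pi ^ 2 * |t| * (n ^ 2 + n) := by field_simp; ring
  rcases hm with rfl | rfl
  · -- winding `+n`
    rw [hEm, hζn]
    have key := neg_re_pow_sub_one_mul_le hζ1 hpos hneg n
    nlinarith [key, hfin]
  · -- winding `-n`
    rw [hEm, hζneg, hζn, map_pow]
    have hζ1' : ‖conj ζ‖ = 1 := by rw [Complex.norm_conj, hζ1]
    have hneg' : ((conj (conj ζ) - 1) * w).re ≤ 0 := by rwa [Complex.conj_conj]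
    have key := neg_re_pow_sub_one_mul_le hζ1' hneg hneg' n
    have hnc : ‖conj ζ - 1‖ = ‖ζ - 1‖ := by
      rw [← Complex.norm_conj (ζ - 1), map_sub, map_one]
    rw [hnc] at key
    nlinarith [key, hfin]

end GaugeTwist

end Summit.HubbardSuperconductivity.HubbardSuperconductivity.Theorems
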